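import Mathlib.Analysis.SpecialFunctions.Trigonometric.InverseDeriv
import Mathlib.Analysis.SpecialFunctions.Complex.Circle
import Mathlib.Analysis.SpecialFunctions.ImproperIntegrals
import Mathlib.Analysis.SpecialFunctions.Gaussian.GaussianIntegral
import Mathlib.MeasureTheory.Integral.IntegralEqImproper
import Mathlib.Analysis.Fourier.Inversion
import Mathlib.MeasureTheory.Measure.Lebesgue.Integral
import Mathlib.Topology.Algebra.Polynomial
import Literature.Analysis.SpecialFunctions.LaguerrePolynomial
import HarnessLib

/-!
# The Laplace transform of the associated Laguerre polynomial `L^{(1)}_n` (Coffey 2010, eq. (122))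
# and the Li kernel on the critical line

Topic `Literature/Analysis/SpecialFunctions`, next to `LaguerrePolynomial.lean` (whose `laguerre α n`
and `laguerreCoeff` this file uses; nothing is re-declared). RH-FREE special-function identities,
requested by the RH criterion column LI (cell `run/shared/lean/pub/rh-li`, DATA.md §N.12 «the Laguerre
bridge»): they identify the weight `1 − cos(nθ(γ))` of a critical zero in Li's `λ_n` with a
Laplace–cosine transform of `L^{(1)}_{n−1}`, which is what makes the prime-power terms
`−(Λ(m)/m) L^{(1)}_{n−1}(log m)` of the Bombieri–Lagarias/Coffey arithmetic formula for `λ_n` and the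
column's zero-side «echo» integrals the same objects.

## What is here (all proved; no named facts)

* `integral_pow_mul_cexp_neg_mul_Ioi` : `∫_0^∞ t^k e^{−st} dt = k!/s^{k+1}` for COMPLEX `s` with
  `Re s > 0` (Mathlib's `integral_cpow_mul_exp_neg_mul_Ioi` has a real rate; proof here by integration by
  parts on `(0, ∞)`), with the integrability and decay lemmas it needs;
* `laguerreCoeff_one` : for `α = 1` the coefficients are binomial, `(−1)^k C(n+1,k+1)/k!`
  [Szegő (5.1.6) specialised];
* `integral_cexp_neg_mul_laguerre_one` : **Coffey 2010, eq. (122)**: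
  `∫_0^∞ e^{−su} L^{(1)}_n(u) du = 1 − (1 − 1/s)^{n+1}` (`Re s > 0`; Coffey's index is `n − 1 ↦ n`);
* `integral_exp_neg_half_mul_cos_mul_laguerre_one` : the real part of (122) at `s = ½ + it`:
  `∫_0^∞ e^{−u/2} cos(tu) L^{(1)}_n(u) du = 1 − cos((n+1)θ(t))`, `θ(t) = 2 arctan(1/(2t))`, `t ≠ 0`;
* `integral_liKernel_mul_cexp`, `integral_liKernel_mul_cos_Ioi` : the FOURIER DUAL — for `y > 0`,
  `∫_ℝ (2 − 2cos((n+1)θ(t))) e^{ity} dt = 2π e^{−y/2} L^{(1)}_n(y)` and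
  `∫_0^∞ (2 − 2cos((n+1)θ(t))) cos(ty) dt = π e^{−y/2} L^{(1)}_n(y)` (Mathlib's Fourier inversion applied
  to the even extension `e^{−|x|/2}L^{(1)}_n(|x|)`, whose transform is computed from (122) at
  `s = ½ ± 2πiw` and dominated by `(8 + 2(n+1)²)/(1 + w²)`).
Private helpers (uncited, elementary): the complex-rate integrability/decay of `t^k e^{−st}`, the power
rule for `t ↦ (t : ℂ)^n`, and the critical-line kernel `1 − 1/(½ + it) = e^{iθ(t)}` (hence
`(1 − 1/ρ)^n = e^{inθ}`) via `cos θ = (4t² − 1)/(4t² + 1)`, `sin θ = 4t/(4t² + 1)`; the Summits-side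
`liZeroAngle t` has the same body `2 arctan(1/(2t))`, so a public copy of the kernel lemma belongs there.

## Deliberately NOT here

Fejér's asymptotic `L^{(1)}_{n−1}(y) ≈ π^{−1/2}e^{y/2}y^{−3/4}n^{1/4}
cos(2√(ny) − 3π/4)` (Coffey (120)); anything about zeros of `ζ` (the identities are about polynomials
and elementary integrals only). The tree's `liZeroAngle` (Summits side) has the same body
`2 arctan(1/(2t))`; it is not imported here (Literature does not depend on Summits).

## References
* [Coffey2010Eta] M. W. Coffey, *The Stieltjes constants, their relation to the η_j coefficients, and
  representation of the Hurwitz zeta function*, Analysis 30 (2010) 383–409 (= arXiv:0706.0343), eq. (122)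
  (and (14)–(17), (120) for context).
* [Szego1975] G. Szegő, *Orthogonal Polynomials*, 4th ed. (1975), (5.1.6).
-/

open Real Complex MeasureTheory Set Filter
open scoped Topology FourierTransform

namespace Literature.Analysis.SpecialFunctions

/-- The half-angle computation behind the Li kernel: with `θ = 2 arctan(1/(2t))`,
`cos θ = (4t² − 1)/(4t² + 1)` and `sin θ = 4t/(4t² + 1)` (`t ≠ 0`). [folklore] -/
private theorem cos_sin_two_arctan_inv_two_mul {t : ℝ} (ht : t ≠ 0) :
    Real.cos (2 * Real.arctan (1 / (2 * t))) = (4 * t ^ 2 - 1) / (4 * t ^ 2 + 1) ∧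
      Real.sin (2 * Real.arctan (1 / (2 * t))) = 4 * t / (4 * t ^ 2 + 1) := by
  set x : ℝ := 1 / (2 * t) with hx
  have h1 : 0 < 1 + x ^ 2 := by positivity
  have hsq : Real.sqrt (1 + x ^ 2) ^ 2 = 1 + x ^ 2 := Real.sq_sqrt h1.le
  have hsq0 : Real.sqrt (1 + x ^ 2) ≠ 0 := (Real.sqrt_pos.2 h1).ne'
  have ht4 : (4 : ℝ) * t ^ 2 + 1 ≠ 0 := by positivity
  constructor
  · rw [Real.cos_two_mul, Real.cos_arctan]
    rw [div_pow, one_pow, hsq, hx]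
    field_simp
    ring
  · rw [Real.sin_two_mul, Real.sin_arctan, Real.cos_arctan, mul_assoc, div_mul_div_comm, ← pow_two, hsq,
      hx]
    field_simp
    ring

/-- **The Li kernel on the critical line.** For real `t ≠ 0`,
`1 − 1/(½ + it) = e^{iθ(t)}` with `θ(t) = 2 arctan(1/(2t))` — so `|1 − 1/ρ| = 1` on `Re ρ = ½` and
`Re (1 − (1 − 1/ρ)^n) = 1 − cos(nθ(t))`, the weight of Li's `λ_n = Σ_ρ [1 − (1 − 1/ρ)^n]` at a critical zero
`ρ = ½ + it`. (At `t = 0` the left side is `−1` while Lean's `1/(2·0) = 0` makes the right side `1`.) [folklore] -/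
private theorem one_sub_inv_half_add_mul_I {t : ℝ} (ht : t ≠ 0) :
    (1 : ℂ) - 1 / (1 / 2 + t * I) = Complex.exp (↑(2 * Real.arctan (1 / (2 * t))) * I) := by
  obtain ⟨hc, hs⟩ := cos_sin_two_arctan_inv_two_mul ht
  have hz : (1 / 2 : ℂ) + t * I ≠ 0 := by
    intro h
    have := congrArg Complex.re h
    simp at this
  rw [Complex.exp_mul_I, ← Complex.ofReal_cos, ← Complex.ofReal_sin, hc, hs]
  rw [show (1 : ℂ) - 1 / (1 / 2 + t * I) = ((1 / 2 + t * I) - 1) / (1 / 2 + t * I) by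
        rw [sub_div, div_self hz],
      div_eq_iff hz]
  have ht4 : (4 : ℝ) * t ^ 2 + 1 ≠ 0 := by positivity
  set c : ℝ := (4 * t ^ 2 - 1) / (4 * t ^ 2 + 1) with hcdef
  set s : ℝ := 4 * t / (4 * t ^ 2 + 1) with hsdef
  have h12 : (1 / 2 : ℂ) = ((1 / 2 : ℝ) : ℂ) := by push_cast; ring
  rw [h12]
  apply Complex.ext
  · simp only [Complex.sub_re, Complex.add_re, Complex.mul_re, Complex.ofReal_re, Complex.ofReal_im,
      Complex.I_re, Complex.I_im, Complex.one_re, Complex.mul_im, Complex.add_im]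
    rw [hcdef, hsdef]
    field_simp
    ring
  · simp only [Complex.sub_im, Complex.add_im, Complex.mul_im, Complex.ofReal_re, Complex.ofReal_im,
      Complex.I_re, Complex.I_im, Complex.one_im, Complex.mul_re, Complex.add_re]
    rw [hcdef, hsdef]
    field_simp
    ring

/-- Powers: `(1 − 1/(½ + it))^n = e^{inθ(t)}`, hence `Re = cos(nθ)`, `Im = sin(nθ)`. [folklore] -/
private theorem one_sub_inv_half_add_mul_I_pow {t : ℝ} (ht : t ≠ 0) (n : ℕ) :
    ((1 : ℂ) - 1 / (1 / 2 + t * I)) ^ n = Complex.exp (↑(n * (2 * Real.arctan (1 / (2 * t)))) * I) := by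
  rw [one_sub_inv_half_add_mul_I ht, ← Complex.exp_nat_mul]
  congr 1
  push_cast
  ring


/-! ### The Laplace transform of a monomial at a complex rate -/

/-- Integrability of `t^k e^{−st}` on `(0, ∞)` for `Re s > 0`. [folklore] -/
private theorem integrableOn_pow_mul_cexp_neg_mul_Ioi (k : ℕ) {s : ℂ} (hs : 0 < s.re) :
    IntegrableOn (fun t : ℝ => (t : ℂ) ^ k * Complex.exp (-(s * t))) (Ioi 0) := by
  have hg : IntegrableOn (fun t : ℝ => t ^ k * Real.exp (-(s.re * t))) (Ioi 0) := by
    have h := integrableOn_rpow_mul_exp_neg_mul_rpow (s := k) (p := 1)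
      (by have : (0 : ℝ) ≤ k := Nat.cast_nonneg k; linarith) le_rfl hs
    refine h.congr_fun (fun t ht => ?_) measurableSet_Ioi
    simp only [Real.rpow_natCast, Real.rpow_one, neg_mul]
  refine Integrable.mono' hg ?_ ?_
  · exact (Continuous.aestronglyMeasurable (by fun_prop)).restrict
  · refine (ae_restrict_iff' measurableSet_Ioi).2 (Filter.Eventually.of_forall fun t ht => ?_)
    rw [norm_mul, norm_pow, Complex.norm_real, Real.norm_of_nonneg (le_of_lt ht), Complex.norm_exp]
    simp

/-- Power rule for `t ↦ (t : ℂ)^n` along the real line. [folklore] -/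
private theorem hasDerivAt_ofReal_pow (n : ℕ) (x : ℝ) :
    HasDerivAt (fun t : ℝ => (t : ℂ) ^ n) (n * (x : ℂ) ^ (n - 1)) x := by
  have h := (hasDerivAt_pow n x).ofReal_comp
  simp only [Complex.ofReal_pow, Complex.ofReal_mul, Complex.ofReal_natCast] at h
  exact h

/-- `t^{k} e^{−st} → 0` as `t → ∞` (`Re s > 0`), in `ℂ`. [folklore] -/
private theorem tendsto_pow_mul_cexp_neg_mul_atTop (k : ℕ) {s : ℂ} (hs : 0 < s.re) :
    Tendsto (fun t : ℝ => (t : ℂ) ^ k * Complex.exp (-(s * t))) atTop (𝓝 0) := by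
  rw [tendsto_zero_iff_norm_tendsto_zero]
  have h1 : Tendsto (fun t : ℝ => (s.re * t) ^ k * Real.exp (-(s.re * t))) atTop (𝓝 0) :=
    (Real.tendsto_pow_mul_exp_neg_atTop_nhds_zero k).comp (tendsto_id.const_mul_atTop hs)
  have h2 : Tendsto (fun t : ℝ => (s.re ^ k)⁻¹ * ((s.re * t) ^ k * Real.exp (-(s.re * t)))) atTop (𝓝 0) := by
    simpa using h1.const_mul ((s.re ^ k)⁻¹)
  refine h2.congr' ?_
  filter_upwards [eventually_gt_atTop (0 : ℝ)] with t ht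
  rw [norm_mul, norm_pow, Complex.norm_real, Real.norm_of_nonneg ht.le, Complex.norm_exp]
  have hsr : s.re ^ k ≠ 0 := pow_ne_zero _ hs.ne'
  simp only [Complex.neg_re, Complex.mul_re, Complex.ofReal_re, Complex.ofReal_im, mul_zero, sub_zero]
  rw [mul_pow]
  field_simp

/-- **Laplace transform of a monomial at a complex rate**: `∫_0^∞ t^k e^{−st} dt = k!/s^{k+1}` for
`Re s > 0`. (Mathlib's `integral_cpow_mul_exp_neg_mul_Ioi` has a real rate; here the rate is complex and
the exponent natural; proof by integration by parts on `(0, ∞)`; DLMF 5.9.1 with `ν = k + 1`,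
`Γ(k+1) = k!`.) [cite: DLMF, 5.9.1] -/
theorem integral_pow_mul_cexp_neg_mul_Ioi (k : ℕ) {s : ℂ} (hs : 0 < s.re) :
    ∫ t : ℝ in Ioi 0, (t : ℂ) ^ k * Complex.exp (-(s * t)) = (k.factorial : ℂ) / s ^ (k + 1) := by
  have hs0 : s ≠ 0 := fun h => by rw [h, Complex.zero_re] at hs; exact lt_irrefl _ hs
  induction k with
  | zero =>
    have h := integral_exp_mul_complex_Ioi (a := -s) (by simpa using hs) 0
    simp only [pow_zero, one_mul, Nat.factorial_zero, Nat.cast_one, zero_add, pow_one]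
    rw [show (fun t : ℝ => Complex.exp (-(s * t))) = fun t : ℝ => Complex.exp (-s * (t : ℂ)) by
      funext t; ring_nf] at *
    rw [h]
    simp only [Complex.ofReal_zero, mul_zero, Complex.exp_zero]
    field_simp
  | succ k IH =>
    -- integration by parts with u = t^{k+1}, v = -e^{-st}/s
    have hu : ∀ x ∈ Ioi (0 : ℝ), HasDerivAt (fun t : ℝ => (t : ℂ) ^ (k + 1))
        (((k + 1 : ℕ) : ℂ) * (x : ℂ) ^ k) x := fun x _ => by
      simpa using hasDerivAt_ofReal_pow (k + 1) x
    have hv : ∀ x ∈ Ioi (0 : ℝ), HasDerivAt (fun t : ℝ => -Complex.exp (-(s * t)) / s)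
        (Complex.exp (-(s * x))) x := fun x _ => by
      have h0 : HasDerivAt (fun t : ℝ => s * (t : ℂ)) (s * (1 : ℝ)) x :=
        ((hasDerivAt_id x).ofReal_comp).const_mul s
      have h1 : HasDerivAt (fun t : ℝ => -(s * (t : ℂ))) (-(s * (1 : ℝ))) x := h0.neg
      have h3 : HasDerivAt (fun t : ℝ => -Complex.exp (-(s * t)) / s)
          (-(Complex.exp (-(s * x)) * -(s * (1 : ℝ))) / s) x := (h1.cexp.neg).div_const s
      refine h3.congr_deriv ?_
      push_cast
      field_simp
    have huv' : IntegrableOn ((fun t : ℝ => (t : ℂ) ^ (k + 1)) * fun t : ℝ => Complex.exp (-(s * t)))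
        (Ioi 0) := integrableOn_pow_mul_cexp_neg_mul_Ioi (k + 1) hs
    have hu'v : IntegrableOn ((fun x : ℝ => ((k + 1 : ℕ) : ℂ) * (x : ℂ) ^ k) *
        fun t : ℝ => -Complex.exp (-(s * t)) / s) (Ioi 0) := by
      have h : IntegrableOn (fun x : ℝ => (-((k + 1 : ℕ) : ℂ) / s) * ((x : ℂ) ^ k * Complex.exp (-(s * x))))
          (Ioi 0) := (integrableOn_pow_mul_cexp_neg_mul_Ioi k hs).const_mul (-((k + 1 : ℕ) : ℂ) / s)
      refine h.congr_fun (fun t _ => ?_) measurableSet_Ioi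
      simp only [Pi.mul_apply]
      field_simp
    have h_zero : Tendsto ((fun t : ℝ => (t : ℂ) ^ (k + 1)) * fun t : ℝ => -Complex.exp (-(s * t)) / s)
        (𝓝[>] 0) (𝓝 0) := by
      have hc : Continuous ((fun t : ℝ => (t : ℂ) ^ (k + 1)) * fun t : ℝ => -Complex.exp (-(s * t)) / s) := by
        rw [Pi.mul_def]; fun_prop
      have h := (hc.tendsto 0).mono_left (nhdsWithin_le_nhds (s := Ioi (0 : ℝ)))
      simpa using h
    have h_infty : Tendsto ((fun t : ℝ => (t : ℂ) ^ (k + 1)) * fun t : ℝ => -Complex.exp (-(s * t)) / s)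
        atTop (𝓝 0) := by
      have h := (tendsto_pow_mul_cexp_neg_mul_atTop (k + 1) hs).div_const (-s)
      rw [zero_div] at h
      refine h.congr' (Filter.Eventually.of_forall fun t => ?_)
      simp only [Pi.mul_apply]
      field_simp
    have step := integral_Ioi_mul_deriv_eq_deriv_mul hu hv huv' hu'v h_zero h_infty
    rw [step, sub_self, zero_sub]
    have hint : ∫ x : ℝ in Ioi 0, ((k + 1 : ℕ) : ℂ) * (x : ℂ) ^ k * (-Complex.exp (-(s * x)) / s)
        = (-((k + 1 : ℕ) : ℂ) / s) * ∫ x : ℝ in Ioi 0, (x : ℂ) ^ k * Complex.exp (-(s * x)) := by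
      rw [← integral_const_mul]
      congr 1; funext t
      field_simp
    rw [hint, IH, Nat.factorial_succ]
    push_cast
    field_simp
    ring

/-! ### `α = 1`: binomial form of the coefficients and Coffey's Laplace transform -/

/-- For `α = 1` the Laguerre coefficients are binomial: `c_k(L_n^{(1)}) = (−1)^k C(n+1, k+1)/k!`
(`(k+2)_{n−k} = (n+1)!/(k+1)!`). [cite: Szego1975, (5.1.6)] -/
theorem laguerreCoeff_one (n k : ℕ) (hk : k ≤ n) :
    laguerreCoeff 1 n k = (-1) ^ k * (Nat.choose (n + 1) (k + 1) : ℝ) / (k.factorial : ℝ) := by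
  rw [laguerreCoeff]
  have hp : (ascPochhammer ℝ (n - k)).eval ((1 : ℝ) + k + 1) = ((k + 2).ascFactorial (n - k) : ℝ) := by
    rw [← ascPochhammer_nat_eq_natCast_ascFactorial ℝ (k + 2) (n - k)]
    congr 1
    push_cast
    ring
  rw [hp]
  -- `(k+1)! · (k+2)^{(n-k)} = (n+1)!` and `C(n+1,k+1) (k+1)! (n-k)! = (n+1)!`
  have h1 : ((k + 1).factorial * (k + 2).ascFactorial (n - k) : ℕ) = (n + 1).factorial := by
    rw [Nat.factorial_mul_ascFactorial (k + 1) (n - k)]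
    congr 1
    omega
  have h2 : (Nat.choose (n + 1) (k + 1) * (k + 1).factorial * (n - k).factorial : ℕ) = (n + 1).factorial := by
    have := Nat.choose_mul_factorial_mul_factorial (n := n + 1) (k := k + 1) (by omega)
    simpa [Nat.succ_sub_succ] using this
  have h1r : ((k + 1).factorial : ℝ) * ((k + 2).ascFactorial (n - k) : ℝ) = ((n + 1).factorial : ℝ) := by
    exact_mod_cast h1
  have h2r : (Nat.choose (n + 1) (k + 1) : ℝ) * ((k + 1).factorial : ℝ) * ((n - k).factorial : ℝ)
      = ((n + 1).factorial : ℝ) := by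
    exact_mod_cast h2
  have hf1 : ((k + 1).factorial : ℝ) ≠ 0 := by positivity
  have hf2 : ((n - k).factorial : ℝ) ≠ 0 := by positivity
  have hf3 : (k.factorial : ℝ) ≠ 0 := by positivity
  -- express ascFactorial and choose through (n+1)!
  have e1 : ((k + 2).ascFactorial (n - k) : ℝ) = ((n + 1).factorial : ℝ) / ((k + 1).factorial : ℝ) := by
    rw [eq_div_iff hf1, mul_comm]; exact h1r
  have e2 : (Nat.choose (n + 1) (k + 1) : ℝ)
      = ((n + 1).factorial : ℝ) / (((k + 1).factorial : ℝ) * ((n - k).factorial : ℝ)) := by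
    rw [eq_div_iff (mul_ne_zero hf1 hf2)]; rw [← h2r]; ring
  rw [e1, e2]
  field_simp

/-- **Coffey 2010, eq. (122)** (the Laplace transform behind the Li/Keiper constants): for `Re s > 0`,
`∫_0^∞ e^{−su} L^{(1)}_{n}(u) du = 1 − (1 − 1/s)^{n+1}` (Coffey writes `L_n(ρ) = ∫_0^∞ e^{−ρu}L^1_{n−1}(u)du
= 1 − (1 − 1/ρ)^n`, so that Li's `λ_n = Σ_ρ L_n(ρ)` over the nontrivial zeros; here the index is shifted
by one to avoid `n − 1`). Proof: termwise Laplace transforms `k!/s^{k+1}` of the binomial coefficients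
`(−1)^k C(n+1,k+1)/k!` and the binomial theorem. RH-free. [cite: Coffey2010Eta, eq. (122)] -/
theorem integral_cexp_neg_mul_laguerre_one (n : ℕ) {s : ℂ} (hs : 0 < s.re) :
    ∫ u : ℝ in Ioi 0, Complex.exp (-(s * u)) * (((laguerre 1 n).eval u : ℝ) : ℂ)
      = 1 - (1 - 1 / s) ^ (n + 1) := by
  have hs0 : s ≠ 0 := fun h => by rw [h, Complex.zero_re] at hs; exact lt_irrefl _ hs
  have hexp : ∀ u : ℝ, Complex.exp (-(s * u)) * (((laguerre 1 n).eval u : ℝ) : ℂ)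
      = ∑ k ∈ Finset.range (n + 1),
          (laguerreCoeff 1 n k : ℂ) * ((u : ℂ) ^ k * Complex.exp (-(s * u))) := by
    intro u
    rw [eval_laguerre]
    push_cast
    rw [Finset.mul_sum]
    refine Finset.sum_congr rfl (fun k _ => ?_)
    ring
  simp_rw [hexp]
  rw [integral_finsetSum _ (fun k _ =>
    ((integrableOn_pow_mul_cexp_neg_mul_Ioi k hs).const_mul (laguerreCoeff 1 n k : ℂ)))]
  have hk : ∀ k ∈ Finset.range (n + 1),
      ∫ u : ℝ in Ioi 0, (laguerreCoeff 1 n k : ℂ) * ((u : ℂ) ^ k * Complex.exp (-(s * u)))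
        = -((-1 / s) ^ (k + 1) * (Nat.choose (n + 1) (k + 1) : ℂ)) := by
    intro k hk
    have hkn : k ≤ n := by simpa [Finset.mem_range, Nat.lt_succ_iff] using hk
    rw [integral_const_mul, integral_pow_mul_cexp_neg_mul_Ioi k hs, laguerreCoeff_one n k hkn, div_pow]
    have hf : (k.factorial : ℂ) ≠ 0 := by exact_mod_cast (Nat.factorial_pos k).ne'
    have hsk : s ^ (k + 1) ≠ 0 := pow_ne_zero _ hs0
    push_cast
    field_simp
    ring
  rw [Finset.sum_congr rfl hk]
  have hb : (1 - 1 / s) ^ (n + 1)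
      = ∑ m ∈ Finset.range (n + 1 + 1), (-1 / s) ^ m * (Nat.choose (n + 1) m : ℂ) := by
    rw [show (1 : ℂ) - 1 / s = -1 / s + 1 by ring, add_pow]
    simp
  rw [hb]
  conv_rhs => rw [Finset.sum_range_succ']
  simp only [pow_zero, Nat.choose_zero_right, Nat.cast_one, mul_one, Finset.sum_neg_distrib]
  ring

/-- Integrability of `e^{−su} L_n^{(1)}(u)` on `(0, ∞)` for `Re s > 0`. [folklore] -/
private theorem integrableOn_cexp_neg_mul_laguerre_one (n : ℕ) {s : ℂ} (hs : 0 < s.re) :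
    IntegrableOn (fun u : ℝ => Complex.exp (-(s * u)) * (((laguerre 1 n).eval u : ℝ) : ℂ)) (Ioi 0) := by
  have hexp : (fun u : ℝ => Complex.exp (-(s * u)) * (((laguerre 1 n).eval u : ℝ) : ℂ))
      = fun u : ℝ => ∑ k ∈ Finset.range (n + 1),
          (laguerreCoeff 1 n k : ℂ) * ((u : ℂ) ^ k * Complex.exp (-(s * u))) := by
    funext u
    rw [eval_laguerre]
    push_cast
    rw [Finset.mul_sum]
    refine Finset.sum_congr rfl (fun k _ => ?_)
    ring
  rw [hexp]
  exact integrable_finsetSum _ (fun k _ =>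
    ((integrableOn_pow_mul_cexp_neg_mul_Ioi k hs).const_mul (laguerreCoeff 1 n k : ℂ)))

/-- **The Li kernel as a Laplace–cosine transform of `L^{(1)}_n`** (Coffey's (122) read on the critical
line `s = ½ + it`, real part): for real `t ≠ 0`,
`∫_0^∞ e^{−u/2} cos(tu) L^{(1)}_n(u) du = 1 − cos((n+1) θ(t))`, `θ(t) = 2 arctan(1/(2t))` — i.e. the
weight `Re(1 − (1 − 1/ρ)^{n+1}) = 1 − cos((n+1)θ(γ))` of a critical zero `ρ = ½ + iγ` in Li's `λ_{n+1}`
is the `e^{−u/2}cos(γu)`-transform of the associated Laguerre polynomial. (By Fourier inversion this is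
equivalent to `∫_0^∞ 2(1 − cos((n+1)θ(t))) cos(ty) dt = π e^{−y/2} L^{(1)}_n(y)` for `y > 0`; that dual
form is not proved here.) RH-free. [cite: Coffey2010Eta, eq. (122)] -/
theorem integral_exp_neg_half_mul_cos_mul_laguerre_one (n : ℕ) {t : ℝ} (ht : t ≠ 0) :
    ∫ u : ℝ in Ioi 0, Real.exp (-(u / 2)) * Real.cos (t * u) * (laguerre 1 n).eval u
      = 1 - Real.cos ((n + 1 : ℕ) * (2 * Real.arctan (1 / (2 * t)))) := by
  have hs : 0 < ((1 / 2 : ℂ) + t * I).re := by simp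
  have hB := integral_cexp_neg_mul_laguerre_one n hs
  rw [one_sub_inv_half_add_mul_I_pow ht (n + 1)] at hB
  have hre := congrArg Complex.re hB
  rw [Complex.sub_re, Complex.one_re, Complex.exp_ofReal_mul_I_re] at hre
  have h2 := integral_re (integrableOn_cexp_neg_mul_laguerre_one n hs)
  simp only [RCLike.re_to_complex] at h2
  rw [← hre, ← h2]
  refine setIntegral_congr_fun measurableSet_Ioi (fun u _ => ?_)
  simp only [Complex.mul_re, Complex.ofReal_re, Complex.ofReal_im, mul_zero, sub_zero,
    Complex.exp_re, Complex.neg_re, Complex.neg_im, Complex.add_re, Complex.add_im, Complex.mul_im,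
    Complex.I_re, Complex.I_im, Real.cos_neg]
  norm_num
  exact Or.inl (Or.inl (by ring))

/-! ### The Fourier dual: the Li kernel `2 − 2cos((n+1)θ(t))` is the Fourier transform of the even
extension of `e^{−|x|/2} L^{(1)}_n(|x|)` -/

/-- The even extension `G(x) = e^{−|x|/2} L_n^{(1)}(|x|)` is continuous. [folklore] -/
private theorem lagExt_continuous (n : ℕ) : Continuous (fun x : ℝ => (((Real.exp (-(|x| / 2)) * (laguerre 1 n).eval |x| : ℝ) : ℂ))) := by
  refine Complex.continuous_ofReal.comp ?_
  exact ((Real.continuous_exp.comp (continuous_abs.div_const 2).neg).mul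
    ((laguerre 1 n).continuous.comp continuous_abs))

/-- On `(0, ∞)`, `(((Real.exp (-(|x| / 2)) * (laguerre 1 n).eval |x| : ℝ) : ℂ)) = e^{−x/2} L_n^{(1)}(x)`. [folklore] -/
private theorem lagExt_eq_of_pos (n : ℕ) {x : ℝ} (hx : 0 < x) :
    (((Real.exp (-(|x| / 2)) * (laguerre 1 n).eval |x| : ℝ) : ℂ)) = Complex.exp (-((1 / 2 : ℂ) * x)) * (((laguerre 1 n).eval x : ℝ) : ℂ) := by
  rw [abs_of_pos hx]
  push_cast
  congr 1
  congr 1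
  ring

/-- The even extension is even. [folklore] -/
private theorem lagExt_neg (n : ℕ) (x : ℝ) : (((Real.exp (-(|-x| / 2)) * (laguerre 1 n).eval |-x| : ℝ) : ℂ)) = (((Real.exp (-(|x| / 2)) * (laguerre 1 n).eval |x| : ℝ) : ℂ)) := by
  rw [abs_neg]

/-- The even extension is integrable on `(0, ∞)`. [folklore] -/
private theorem integrableOn_lagExt_Ioi (n : ℕ) : IntegrableOn (fun x : ℝ => (((Real.exp (-(|x| / 2)) * (laguerre 1 n).eval |x| : ℝ) : ℂ))) (Ioi 0) := by
  have hs : 0 < ((1 / 2 : ℂ)).re := by norm_num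
  refine (integrableOn_cexp_neg_mul_laguerre_one n hs).congr_fun (fun x hx => ?_) measurableSet_Ioi
  exact (lagExt_eq_of_pos n hx).symm

/-- The even extension is integrable on `ℝ`. [folklore] -/
private theorem integrable_lagExt (n : ℕ) : Integrable (fun x : ℝ => (((Real.exp (-(|x| / 2)) * (laguerre 1 n).eval |x| : ℝ) : ℂ))) := by
  have hIoi := integrableOn_lagExt_Ioi n
  have hIic : IntegrableOn (fun x : ℝ => (((Real.exp (-(|x| / 2)) * (laguerre 1 n).eval |x| : ℝ) : ℂ))) (Iic 0) := by
    rw [← Measure.map_neg_eq_self (volume : Measure ℝ)]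
    let m : MeasurableEmbedding fun x : ℝ => -x := (Homeomorph.neg ℝ).measurableEmbedding
    rw [m.integrableOn_map_iff]
    simp_rw [Function.comp_def, lagExt_neg, neg_preimage, neg_Iic, neg_zero]
    exact Iff.mpr integrableOn_Ici_iff_integrableOn_Ioi hIoi
  have h := hIic.union hIoi
  rwa [Iic_union_Ioi, integrableOn_univ] at h

/-- The Fourier transform of the even extension away from `0`: `𝓕 G w = 2 − 2cos((n+1)θ(2πw))`
(Coffey's (122) at `s = ½ ± 2πiw`). [folklore] -/
private theorem fourier_lagExt (n : ℕ) {w : ℝ} (hw : w ≠ 0) :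
    𝓕 (fun x : ℝ => (((Real.exp (-(|x| / 2)) * (laguerre 1 n).eval |x| : ℝ) : ℂ))) w = ((2 - 2 * Real.cos ((n + 1 : ℕ) * (2 * Real.arctan (1 / (2 * (2 * π * w))))) : ℝ) : ℂ) := by
  rw [Real.fourier_real_eq_integral_exp_smul]
  simp only [smul_eq_mul]
  set t : ℝ := 2 * π * w with htdef
  have ht : t ≠ 0 := by rw [htdef]; positivity
  have hs1 : 0 < ((1 / 2 : ℂ) + t * I).re := by simp
  have hs2 : 0 < ((1 / 2 : ℂ) + ↑(-t) * I).re := by simp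
  -- integrability of the Fourier integrand on the two half-lines
  have hint : Integrable (fun v : ℝ => Complex.exp (↑(-2 * π * v * w) * I) * (((Real.exp (-(|v| / 2)) * (laguerre 1 n).eval |v| : ℝ) : ℂ))) := by
    refine (integrable_lagExt n).bdd_mul (c := 1) ?_ ?_
    · exact (Continuous.aestronglyMeasurable (by fun_prop))
    · refine Filter.Eventually.of_forall (fun v => ?_)
      rw [Complex.norm_exp_ofReal_mul_I]
  rw [← intervalIntegral.integral_Iic_add_Ioi hint.integrableOn hint.integrableOn]
  -- right half-line
  have hR : ∫ v in Ioi (0 : ℝ), Complex.exp (↑(-2 * π * v * w) * I) * (((Real.exp (-(|v| / 2)) * (laguerre 1 n).eval |v| : ℝ) : ℂ))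
      = 1 - (1 - 1 / ((1 / 2 : ℂ) + t * I)) ^ (n + 1) := by
    rw [← integral_cexp_neg_mul_laguerre_one n hs1]
    refine setIntegral_congr_fun measurableSet_Ioi (fun v hv => ?_)
    rw [lagExt_eq_of_pos n hv, ← mul_assoc, ← Complex.exp_add]
    congr 2
    rw [htdef]; push_cast; ring
  -- left half-line, reflected
  have hL : ∫ v in Iic (0 : ℝ), Complex.exp (↑(-2 * π * v * w) * I) * (((Real.exp (-(|v| / 2)) * (laguerre 1 n).eval |v| : ℝ) : ℂ))
      = 1 - (1 - 1 / ((1 / 2 : ℂ) + ↑(-t) * I)) ^ (n + 1) := by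
    rw [← integral_cexp_neg_mul_laguerre_one n hs2, ← neg_zero, ← integral_comp_neg_Ioi 0, neg_zero]
    refine setIntegral_congr_fun measurableSet_Ioi (fun v hv => ?_)
    simp only [lagExt_neg]
    rw [lagExt_eq_of_pos n hv, ← mul_assoc, ← Complex.exp_add]
    congr 2
    rw [htdef]; push_cast; ring
  rw [hR, hL, one_sub_inv_half_add_mul_I_pow ht, one_sub_inv_half_add_mul_I_pow (neg_ne_zero.mpr ht)]
  have hodd : 2 * Real.arctan (1 / (2 * -t)) = -(2 * Real.arctan (1 / (2 * t))) := by
    rw [show (1 : ℝ) / (2 * -t) = -(1 / (2 * t)) by ring, Real.arctan_neg]; ring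
  rw [hodd]
  have key : ∀ θ : ℝ, (1 : ℂ) - Complex.exp (↑(((n + 1 : ℕ) : ℝ) * θ) * I)
      + (1 - Complex.exp (↑(((n + 1 : ℕ) : ℝ) * -θ) * I))
      = ((2 - 2 * Real.cos ((n + 1 : ℕ) * θ) : ℝ) : ℂ) := by
    intro θ
    push_cast
    rw [Complex.two_cos]
    simp only [mul_neg, neg_mul]
    ring
  rw [add_comm]
  exact key _

/-- `|arctan u| ≤ |u|`. [folklore] -/
private theorem abs_arctan_le_abs (u : ℝ) : |Real.arctan u| ≤ |u| := by
  have key : ∀ v : ℝ, 0 ≤ v → Real.arctan v ≤ v := fun v hv => by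
    have h := Real.le_tan (Real.arctan_nonneg.2 hv) (Real.arctan_lt_pi_div_two v)
    rwa [Real.tan_arctan] at h
  rcases le_or_gt 0 u with hu | hu
  · rw [abs_of_nonneg (Real.arctan_nonneg.2 hu), abs_of_nonneg hu]; exact key u hu
  · rw [abs_of_neg (by simpa [Real.arctan_lt_zero] using hu), abs_of_neg hu, ← Real.arctan_neg]
    exact key (-u) (by linarith)

/-- Pointwise bound `|2 − 2cos((n+1)θ(2πw))| ≤ (8 + 2(n+1)²)/(1 + w²)`. [folklore] -/
private theorem norm_liKer_le (n : ℕ) (w : ℝ) :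
    ‖(((2 - 2 * Real.cos ((n + 1 : ℕ) * (2 * Real.arctan (1 / (2 * (2 * π * w))))) : ℝ) : ℂ))‖ ≤ (8 + 2 * ((n : ℝ) + 1) ^ 2) * (1 + w ^ 2)⁻¹ := by
  rw [Complex.norm_real, Real.norm_eq_abs]
  set x : ℝ := (n + 1 : ℕ) * (2 * Real.arctan (1 / (2 * (2 * π * w)))) with hx
  have hc1 := Real.cos_le_one x
  have hc2 := Real.neg_one_le_cos x
  have hc3 := Real.one_sub_sq_div_two_le_cos (x := x)
  have h4 : |2 - 2 * Real.cos x| ≤ 4 := by rw [abs_le]; constructor <;> linarith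
  have hsq : |2 - 2 * Real.cos x| ≤ x ^ 2 := by
    rw [abs_of_nonneg (by linarith)]; linarith
  have hpos : 0 < 1 + w ^ 2 := by positivity
  have ha : 0 ≤ ((n : ℝ) + 1) ^ 2 := sq_nonneg _
  rcases le_or_gt (w ^ 2) 1 with hw | hw
  · -- small w: use the bound 4
    calc |2 - 2 * Real.cos x| ≤ 4 := h4
      _ ≤ (8 + 2 * ((n : ℝ) + 1) ^ 2) * (1 + w ^ 2)⁻¹ := by
        rw [← div_eq_mul_inv, le_div_iff₀ hpos]; nlinarith
  · -- large w: use x² ≤ (n+1)²/w²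
    have hw0 : w ≠ 0 := by rintro rfl; norm_num at hw
    have hθ : |2 * Real.arctan (1 / (2 * (2 * π * w)))| ≤ 1 / |w| := by
      rw [abs_mul, abs_two]
      have h1 := abs_arctan_le_abs (1 / (2 * (2 * π * w)))
      have h2 : |1 / (2 * (2 * π * w))| = 1 / (4 * π * |w|) := by
        rw [abs_div, abs_one, abs_mul, abs_mul, abs_mul, abs_two, abs_of_pos Real.pi_pos]; ring
      rw [h2] at h1
      have hπ : (1 : ℝ) ≤ π := by linarith [Real.two_le_pi]
      have hwpos : 0 < |w| := abs_pos.2 hw0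
      calc 2 * |Real.arctan (1 / (2 * (2 * π * w)))| ≤ 2 * (1 / (4 * π * |w|)) := by linarith
        _ ≤ 1 / |w| := by
          rw [mul_one_div, div_le_div_iff₀ (by positivity) hwpos]; nlinarith
    have hx2 : x ^ 2 ≤ ((n : ℝ) + 1) ^ 2 / w ^ 2 := by
      have : |x| ≤ ((n : ℝ) + 1) * (1 / |w|) := by
        rw [hx, abs_mul]
        push_cast
        rw [abs_of_nonneg (by positivity : (0 : ℝ) ≤ (n : ℝ) + 1)]
        exact mul_le_mul_of_nonneg_left hθ (by positivity)
      calc x ^ 2 = |x| ^ 2 := (sq_abs x).symm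
        _ ≤ (((n : ℝ) + 1) * (1 / |w|)) ^ 2 := pow_le_pow_left₀ (abs_nonneg x) this 2
        _ = ((n : ℝ) + 1) ^ 2 / w ^ 2 := by rw [mul_pow, div_pow, one_pow, sq_abs]; ring
    have hwsq : 0 < w ^ 2 := by positivity
    calc |2 - 2 * Real.cos x| ≤ ((n : ℝ) + 1) ^ 2 / w ^ 2 := hsq.trans hx2
      _ ≤ (8 + 2 * ((n : ℝ) + 1) ^ 2) * (1 + w ^ 2)⁻¹ := by
        rw [← div_eq_mul_inv, div_le_div_iff₀ hwsq hpos]; nlinarith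

/-- The Li kernel is integrable in the Fourier variable. [folklore] -/
private theorem integrable_liKer (n : ℕ) : Integrable (fun w : ℝ => (((2 - 2 * Real.cos ((n + 1 : ℕ) * (2 * Real.arctan (1 / (2 * (2 * π * w))))) : ℝ) : ℂ))) := by
  refine Integrable.mono' ((integrable_inv_one_add_sq).const_mul (8 + 2 * ((n : ℝ) + 1) ^ 2)) ?_
    (Filter.Eventually.of_forall (norm_liKer_le n))
  exact (Measurable.aestronglyMeasurable (by fun_prop))

/-- The Fourier transform of the even extension equals the Li kernel almost everywhere. [folklore] -/
private theorem fourier_lagExt_ae (n : ℕ) : 𝓕 (fun x : ℝ => (((Real.exp (-(|x| / 2)) * (laguerre 1 n).eval |x| : ℝ) : ℂ))) =ᵐ[volume]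
      (fun w : ℝ => (((2 - 2 * Real.cos ((n + 1 : ℕ) * (2 * Real.arctan (1 / (2 * (2 * π * w))))) : ℝ) : ℂ))) := by
  have hae : ∀ᵐ w : ℝ ∂volume, w ≠ 0 := by
    simp [ae_iff]
  filter_upwards [hae] with w hw
  rw [fourier_lagExt n hw]

/-- `𝓕 (fun x : ℝ => (((Real.exp (-(|x| / 2)) * (laguerre 1 n).eval |x| : ℝ) : ℂ)))` is integrable. [folklore] -/
private theorem integrable_fourier_lagExt (n : ℕ) : Integrable (𝓕 (fun x : ℝ => (((Real.exp (-(|x| / 2)) * (laguerre 1 n).eval |x| : ℝ) : ℂ)))) :=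
  (integrable_liKer n).congr (fourier_lagExt_ae n).symm

/-- **The Li kernel is the Fourier transform of `e^{−|y|/2} L^{(1)}_n(|y|)`** (Fourier dual of Coffey's
(122) on the critical line): for `y > 0`,
`∫_ℝ (2 − 2cos((n+1)θ(t))) e^{ity} dt = 2π e^{−y/2} L^{(1)}_n(y)`, `θ(t) = 2 arctan(1/(2t))`.
Since the kernel is real and even this says `∫_0^∞ 2(1 − cos((n+1)θ(t))) cos(ty) dt = π e^{−y/2}L^{(1)}_n(y)`:
the critical-line weight of Li's `λ_{n+1}` transforms into the associated Laguerre polynomial at `y = log x`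
(so a prime power `m` contributes `(Λ(m)/m)·L^{(1)}_n(log m)` — the Bombieri–Lagarias/Coffey term).
Proof: Fourier inversion (Mathlib) applied to the even extension, whose transform is computed from (122) at
`s = ½ ± 2πiw`. RH-free. [cite: Coffey2010Eta, eq. (122)] -/
theorem integral_liKernel_mul_cexp (n : ℕ) {y : ℝ} (hy : 0 < y) :
    ∫ t : ℝ, ((2 - 2 * Real.cos ((n + 1 : ℕ) * (2 * Real.arctan (1 / (2 * t))))) : ℝ)
        * Complex.exp (↑(t * y) * I)
      = ((2 * π * (Real.exp (-(y / 2)) * (laguerre 1 n).eval y) : ℝ) : ℂ) := by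
  have hinv := (integrable_lagExt n).fourierInv_fourier_eq (integrable_fourier_lagExt n)
    ((lagExt_continuous n).continuousAt (x := y))
  rw [Real.fourierInv_eq_fourier_neg, Real.fourier_real_eq_integral_exp_smul] at hinv
  -- replace `𝓕 (fun x : ℝ => (((Real.exp (-(|x| / 2)) * (laguerre 1 n).eval |x| : ℝ) : ℂ)))` by the explicit kernel inside the integral
  have hcongr : ∫ v : ℝ, Complex.exp (↑(-2 * π * v * -y) * I) • 𝓕 (fun x : ℝ => (((Real.exp (-(|x| / 2)) * (laguerre 1 n).eval |x| : ℝ) : ℂ))) v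
      = ∫ v : ℝ, Complex.exp (↑(-2 * π * v * -y) * I) • (((2 - 2 * Real.cos ((n + 1 : ℕ) * (2 * Real.arctan (1 / (2 * (2 * π * v))))) : ℝ) : ℂ)) := by
    refine integral_congr_ae ?_
    filter_upwards [fourier_lagExt_ae n] with v hv
    rw [hv]
  rw [hcongr] at hinv
  -- substitute t = 2π v
  set Φ : ℝ → ℂ := fun t => ((2 - 2 * Real.cos ((n + 1 : ℕ) * (2 * Real.arctan (1 / (2 * t))))) : ℝ)
        * Complex.exp (↑(t * y) * I) with hΦ
  have hsub : (fun v : ℝ => Complex.exp (↑(-2 * π * v * -y) * I) • (((2 - 2 * Real.cos ((n + 1 : ℕ) * (2 * Real.arctan (1 / (2 * (2 * π * v))))) : ℝ) : ℂ))) = fun v => Φ (2 * π * v) := by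
    funext v
    simp only [hΦ, smul_eq_mul]
    rw [mul_comm]
    congr 2
    push_cast
    ring
  rw [hsub, Measure.integral_comp_mul_left Φ (2 * π)] at hinv
  -- solve for `∫ Φ`
  have h2π : (0 : ℝ) < 2 * π := by positivity
  rw [abs_of_pos (inv_pos.2 h2π), Complex.real_smul] at hinv
  have hval : (((Real.exp (-(|y| / 2)) * (laguerre 1 n).eval |y| : ℝ) : ℂ)) = ((Real.exp (-(y / 2)) * (laguerre 1 n).eval y : ℝ) : ℂ) := by
    rw [abs_of_pos hy]
  rw [hval] at hinv
  have hne : ((2 * π)⁻¹ : ℝ) ≠ 0 := inv_ne_zero h2π.ne'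
  have hne' : (((2 * π)⁻¹ : ℝ) : ℂ) ≠ 0 := Complex.ofReal_ne_zero.2 hne
  calc ∫ t : ℝ, Φ t = (((2 * π)⁻¹ : ℝ) : ℂ)⁻¹ * ((((2 * π)⁻¹ : ℝ) : ℂ) * ∫ t : ℝ, Φ t) := by
        rw [← mul_assoc, inv_mul_cancel₀ hne', one_mul]
    _ = (((2 * π)⁻¹ : ℝ) : ℂ)⁻¹ * ((Real.exp (-(y / 2)) * (laguerre 1 n).eval y : ℝ) : ℂ) := by rw [hinv]
    _ = ((2 * π * (Real.exp (-(y / 2)) * (laguerre 1 n).eval y) : ℝ) : ℂ) := by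
        push_cast
        field_simp

/-- **Cosine form on the half-line** (the statement used by the Li column, cell `rh-li` DATA.md §N.12):
for `y > 0`, `∫_0^∞ 2(1 − cos((n+1)θ(t))) cos(ty) dt = π e^{−y/2} L^{(1)}_n(y)`, `θ(t) = 2 arctan(1/(2t))`
(real part and evenness applied to `integral_liKernel_mul_cexp`). With `y = log m` this is the statement
that the critical-line Li weight `h_{n+1}(t) = 2(1 − cos((n+1)θ(t)))` integrates the prime power `m`
(weight `Λ(m) m^{−1/2} cos(t log m)/π`) to EXACTLY the Bombieri–Lagarias/Coffey term
`(Λ(m)/m) L^{(1)}_n(log m)` of the arithmetic formula for `λ_{n+1}`. RH-free. [cite: Coffey2010Eta, eq. (122)] -/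
theorem integral_liKernel_mul_cos_Ioi (n : ℕ) {y : ℝ} (hy : 0 < y) :
    ∫ t : ℝ in Ioi 0, (2 - 2 * Real.cos ((n + 1 : ℕ) * (2 * Real.arctan (1 / (2 * t))))) * Real.cos (t * y)
      = π * (Real.exp (-(y / 2)) * (laguerre 1 n).eval y) := by
  set k : ℝ → ℝ := fun t => 2 - 2 * Real.cos ((n + 1 : ℕ) * (2 * Real.arctan (1 / (2 * t)))) with hk
  have hC := integral_liKernel_mul_cexp n hy
  -- integrability of the complex integrand
  have h2π : (2 * π : ℝ) ≠ 0 := by positivity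
  have hkint : Integrable (fun t : ℝ => ((k t : ℝ) : ℂ)) := by
    have h := (integrable_liKer n).comp_mul_left' (inv_ne_zero h2π)
    refine h.congr (Filter.Eventually.of_forall (fun t => ?_))
    simp only [hk]
    congr 6
    field_simp
  have hΦint : Integrable (fun t : ℝ => ((k t : ℝ) : ℂ) * Complex.exp (↑(t * y) * I)) := by
    refine hkint.mul_bdd (c := 1) ?_ ?_
    · exact (Continuous.aestronglyMeasurable (by fun_prop))
    · refine Filter.Eventually.of_forall (fun v => ?_)
      rw [Complex.norm_exp_ofReal_mul_I]
  -- real parts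
  have hre := congrArg Complex.re hC
  have h2 := integral_re hΦint
  simp only [RCLike.re_to_complex] at h2
  rw [← h2, Complex.ofReal_re] at hre
  have hre' : ∫ t : ℝ, k t * Real.cos (t * y) = 2 * π * (Real.exp (-(y / 2)) * (laguerre 1 n).eval y) := by
    rw [← hre]
    congr 1
    funext t
    simp only [Complex.mul_re, Complex.ofReal_re, Complex.ofReal_im, Complex.exp_ofReal_mul_I_re,
      Complex.exp_ofReal_mul_I_im, zero_mul, sub_zero]
  -- evenness: `∫_ℝ = 2 ∫_{(0,∞)}`
  have heven : ∀ t : ℝ, k t * Real.cos (t * y) = k |t| * Real.cos (|t| * y) := by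
    intro t
    rcases le_or_gt 0 t with ht | ht
    · rw [abs_of_nonneg ht]
    · rw [abs_of_neg ht, hk]
      simp only []
      rw [show (1 : ℝ) / (2 * -t) = -(1 / (2 * t)) by ring, Real.arctan_neg, mul_neg, mul_neg,
        Real.cos_neg, neg_mul, Real.cos_neg]
  have habs := integral_comp_abs (f := fun t => k t * Real.cos (t * y))
  rw [show (fun t : ℝ => k |t| * Real.cos (|t| * y)) = fun t => k t * Real.cos (t * y) from
    (funext heven).symm, hre'] at habs
  have : ∫ t : ℝ in Ioi 0, k t * Real.cos (t * y) = π * (Real.exp (-(y / 2)) * (laguerre 1 n).eval y) := by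
    linarith
  simpa [hk] using this

end Literature.Analysis.SpecialFunctions
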